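import Literature.MathematicalPhysics.QuantumFieldTheory.WilsonFinTorusMagneticSliceKernel
import Literature.MathematicalPhysics.QuantumFieldTheory.WilsonFinTorusTHooftDuality
import HarnessLib

/-!
# 't Hooft's flux free energies WITH MAGNETIC FLUX are transfer-matrix positive:
# `e^{−βF(e, m; a, β)} = Tr_m P(e) e^{−βH_m} ≥ 0` for every `(e, m)` on every finite box

Topic `Literature/MathematicalPhysics/QuantumFieldTheory`; sequel of `WilsonFinTorusMagneticSliceKernel.lean` (the
magnetically twisted slice kernel `K^w_β = finTorusSliceKernelTw ρ β w`, its Lüscher positivity, the time slicing of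
't Hooft's `W{k, m; a_μ}` as the twisted-kernel chain `Tr_m(Ω[k] 𝕋_m^{a₀})`, the exposed eigenbasis of `𝕋_m`, Hopf's bound in
every magnetic sector) and of `WilsonFinTorusElectricFluxSectors.lean` (the same story WITHOUT magnetic flux:
`wilsonFinTorusFluxPartition`, `m = 0`).  The object of `WilsonFinTorusTHooftDuality.lean`,
`wilsonFinTorusFluxTransform ρ β φ ψ₀ ψ₁ ψ₂ m₁₂ m₀₂ m₀₁ a b c d` — 't Hooft's `e^{−βF(e, m; a, β)}` of (5.4) with magnetic flux,
over which the exact duality (6.3) is proved there — is shown here to be REAL AND NON-NEGATIVE for every electric flux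
`(ψ₀, ψ₁, ψ₂)`, every magnetic flux `(m₁₂, m₀₂, m₀₁)`, every box `a × b × c × (M+2)`, every compact `G`, continuous unitary `ρ`,
`β ≥ 0` and every hom-like centre-valued twist map `φ : Γ → Z(G)`.

G. 't Hooft, Nucl. Phys. B 153 (1979) 141 [reprint C. Rebbi (ed.) 1983, pp. 550–553]: §3 «all classical field configurations
carry a well-specified amount of magnetic flux … `(m₁, m₂, m₃) = m`»; §4 (4.1)–(4.5) (the box Hilbert space with twisted
boundary conditions in 3-space carries the centre rotations `Ω[k]`, «an invariance of the Hamiltonian»); §5 (5.1)–(5.4)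
«`e^{−βF} = Tr P(e, m) e^{−βH}` … P is a projection operator that selects the required electric flux e and magnetic flux m … We
saw how to select the magnetic flux m [the integers `m_i` of (2.5)] … `e^{−βF(e,m;a,β)} = N⁻³ Σ_k e^{−2πi(k·e)/N} W{k, m; a_μ}` (5.4)».
On the lattice (5.4) is a DEFINITION; positivity of its left side is the CONTENT of (5.1) (a trace of a positive operator
against a projection commuting with it), and this file makes it a theorem for Wilson's action in every magnetic sector.

Contents (all PROVED; two small definitions with bodies):

* `wilsonFinTorusMagneticFluxPartition ρ β zM φ ψ b₁ b₂ b₃ n := |Γ|⁻¹ Σ_k conj ψ(k) · W{elecMagTwistTensor (φ k) zM}(b₁,b₂,b₃,n)` —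
  (5.4) at a fixed magnetic twist tensor `zM` (ARBITRARY, `G`-valued), for a finite abelian group `Γ` of central temporal
  twists `φ : Γ → (Fin 4 → G)`; `…_one`: `zM = 1` is the companion file's `wilsonFinTorusFluxPartition`;
* `sum_wilsonFinTorusMagneticFluxPartition` (`Σ_ψ Z_{ψ,m} = W{0, m}`), `sum_apply_mul_…` (inversion);
* ★ `wilsonFinTorusMagneticFluxPartition_nonneg` — **`e^{−βF(e,m)} ≥ 0` AND REAL in every magnetic sector**, every box
  `b₁ × b₂ × b₃ × (M+2)` (odd sides included), every compact `G`, continuous unitary `ρ`, `β ≥ 0`: the flux-sector trace formula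
  `Z_{ψ,m}(M+2) = Σᵢ λᵢ(m)^M qᵢ(ψ)` over the eigenbasis of the POSITIVE twisted transfer operator `𝕋_m`
  (`Literature.Analysis.OperatorTheory.fluxSector_nonneg`); `re_…_le` (`Z_{ψ,m} ≤ W{0,m}`);
* ★ `exists_magneticFluxSpectralData_wilsonFinTorus` — `λ₀(m) = ‖𝕋_m‖ > 0` with `λ₀(m)^{M+2} ≤ Re Z_{0,m}(M+2)` (the ground state
  of the magnetic sector is electric-flux free), `Re Z_{ψ,m}(2) ≤ W{0,m}(2) − λ₀(m)²` and
  **`Re Z_{ψ,m}(M+2) ≤ (tanh(3Nβ·b₁b₂b₃)·λ₀(m))^M · Re Z_{ψ,m}(2)` for `ψ ≠ 0`** — adding electric flux to a magnetic sector costs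
  at least Hopf's (explicit, volume-dependent) gap of the box; `…_zero_pos`;
* `tripleFluxChar ψ₀ ψ₁ ψ₂ : AddChar (Γ × Γ × Γ) ℂ` and the BRIDGE `wilsonFinTorusFluxTransform_eq_magneticFluxPartition` — the
  nested triple transform of `WilsonFinTorusTHooftDuality.lean` is the `Γ³`-sector partition function at the magnetic tensor
  `φ ∘ twistIdx 0 0 0 m₁₂ m₀₂ m₀₁`; hence ★ `wilsonFinTorusFluxTransform_nonneg` (**`e^{−βF(e,m;a,β)} ≥ 0` and real for EVERY
  `(e, m)`**), `sum_sum_sum_wilsonFinTorusFluxTransform` (`Σ_e e^{−βF(e,m)} = W{0, m}`), `re_wilsonFinTorusFluxTransform_le`, and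
  ★ `exists_fluxTransformSpectralData_wilsonFinTorus` (vacuum of the `m`-sector and Hopf decay of every `e ≠ 0` at fixed `m`).

HONEST FRAMING: one finite box at fixed `β`; the tree's site-reflection proof `MultiTwist.electricFluxWeight_nonneg`
(`ElectricFluxPositivity.lean`, symmetric EVEN torus, `SU(N)`) gave this sign before for even symmetric boxes; the present
transfer-matrix proof needs no reflection and no parity and covers every anisotropic box, but it is bookkeeping: the Hopf
rate `tanh(3Nβ·b₁b₂b₃) → 1` in the volume, nothing is said about `a_i → ∞` ('t Hooft §7–§8), light∕heavy fluxes, string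
tension, confinement or a mass gap.  The Yang–Mills mass gap (Clay) is NOT proved by any of this; R4 closes only the
conditional finite-𝕋⁴ rung `BalabanLadder.UV`.  No `instance`, no `notation`, no `sorry`; standard axioms.

References: G. 't Hooft, Nucl. Phys. B 153 (1979) 141, §§3–6; J. Greensite, *An Introduction to the Confinement Problem*
(2011) §4.4 (4.41)–(4.44); M. Lüscher, Commun. Math. Phys. 54 (1977) 283; E. Hopf, J. Math. Mech. 12 (1963) 683, Thm 4;
J.-P. Serre, *Linear Representations of Finite Groups* (1977) §2.3 Thm 3, §2.6 Thm 8 (ii); M. Reed, B. Simon IV (1978)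
Thm XIII.43–44.
-/

noncomputable section

open MeasureTheory Filter Function Finset
open scoped ENNReal ComplexConjugate BigOperators
open Literature.Analysis.OperatorTheory

namespace Literature.MathematicalPhysics.QuantumFieldTheory

variable {G : Type*} [Group G] [TopologicalSpace G] [IsTopologicalGroup G] [CompactSpace G]
  [MeasurableSpace G] [BorelSpace G] {N : ℕ} (ρ : G →* Matrix (Fin N) (Fin N) ℂ)
  {Γ : Type*} [AddCommGroup Γ] [Fintype Γ]

/-! ### §1 The electric-flux sectors at a fixed magnetic twist -/

/-- **'t Hooft's electric-flux partition function IN THE MAGNETIC SECTOR `zM`** of the box `b₁ × b₂ × b₃ × n`, flux `ψ ∈ Γ̂`, for a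
finite abelian group `Γ` of temporal twists `φ : Γ → (Fin 4 → G)` and an arbitrary magnetic twist tensor `zM`:
`Z_{ψ,m} := |Γ|⁻¹ Σ_{k ∈ Γ} conj ψ(k) · W{elecMagTwistTensor (φ k) zM}(b₁,b₂,b₃,n)` — verbatim (5.4),
`e^{−βF(e, m; a, β)} = N⁻³ Σ_k e^{−2πi(k·e)/N} W{k, m; a_μ}`. [cite: tHooft1979Flux, §5 (5.4)] [cite: Greensite2011, §4.4 (4.44)] -/
def wilsonFinTorusMagneticFluxPartition (β : ℝ) (zM : Fin 4 → Fin 4 → G) (φ : Γ → Fin 4 → G) (ψ : AddChar Γ ℂ)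
    (b₁ b₂ b₃ n : ℕ) : ℂ :=
  (Fintype.card Γ : ℂ)⁻¹ * ∑ k, conj (ψ k) *
    (wilsonFinTorusTensorTwistedPartition ρ β (elecMagTwistTensor (φ k) zM) b₁ b₂ b₃ n : ℂ)

/-- Unfolding lemma. [cite: tHooft1979Flux, §5 (5.4)] -/
theorem wilsonFinTorusMagneticFluxPartition_def (β : ℝ) (zM : Fin 4 → Fin 4 → G) (φ : Γ → Fin 4 → G) (ψ : AddChar Γ ℂ)
    (b₁ b₂ b₃ n : ℕ) :
    wilsonFinTorusMagneticFluxPartition ρ β zM φ ψ b₁ b₂ b₃ n =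
      (Fintype.card Γ : ℂ)⁻¹ * ∑ k, conj (ψ k) *
        (wilsonFinTorusTensorTwistedPartition ρ β (elecMagTwistTensor (φ k) zM) b₁ b₂ b₃ n : ℂ) := rfl

/-- **No magnetic flux is the companion file's (5.4)**: `Z_{ψ, m=0} = wilsonFinTorusFluxPartition ρ β φ ψ`.
[cite: tHooft1979Flux, §5 (5.4)] -/
theorem wilsonFinTorusMagneticFluxPartition_one (β : ℝ) (φ : Γ → Fin 4 → G) (ψ : AddChar Γ ℂ) (b₁ b₂ b₃ n : ℕ) :
    wilsonFinTorusMagneticFluxPartition ρ β (1 : Fin 4 → Fin 4 → G) φ ψ b₁ b₂ b₃ n =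
      wilsonFinTorusFluxPartition ρ β φ ψ b₁ b₂ b₃ n := by
  simp only [wilsonFinTorusMagneticFluxPartition, wilsonFinTorusFluxPartition_def,
    wilsonFinTorusTensorTwistedPartition_elecMag_one]

/-- **Completeness of the electric sectors at fixed magnetic flux**: `Σ_ψ Z_{ψ,m} = W{0, m}` — the sectors add up to the purely
magnetically twisted functional integral `Tr_m 𝕋_m^n` (only `φ 0 = 1` is used; every `n`, every real `β`).
[cite: tHooft1979Flux, §5 (5.2)–(5.4)] [cite: Serre1977, §2.6 Thm 8 (ii)] -/
theorem sum_wilsonFinTorusMagneticFluxPartition (β : ℝ) (zM : Fin 4 → Fin 4 → G) {φ : Γ → Fin 4 → G} (hφ0 : φ 0 = 1)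
    (b₁ b₂ b₃ n : ℕ) :
    ∑ ψ : AddChar Γ ℂ, wilsonFinTorusMagneticFluxPartition ρ β zM φ ψ b₁ b₂ b₃ n =
      (wilsonFinTorusTensorTwistedPartition ρ β (elecMagTwistTensor (1 : Fin 4 → G) zM) b₁ b₂ b₃ n : ℂ) := by
  have h := sum_fluxSector (Γ := Γ)
    (fun k n' => wilsonFinTorusTensorTwistedPartition ρ β (elecMagTwistTensor (φ k) zM) b₁ b₂ b₃ n') n
  simp only [hφ0] at h
  exact h

/-- **Inversion**: `W{elecMag (φ k₀) zM} = Σ_ψ ψ(k₀) Z_{ψ,m}` — `Tr_m(Ω[k] 𝕋_m^n) = Σ_e e^{2πi(k·e)/N} e^{−βF(e,m)}`.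
[cite: tHooft1979Flux, §5 (5.3)–(5.4)] [cite: Serre1977, §2.3 Thm 3 and §2.6 Thm 8 (ii)] -/
theorem sum_apply_mul_wilsonFinTorusMagneticFluxPartition (β : ℝ) (zM : Fin 4 → Fin 4 → G) (φ : Γ → Fin 4 → G)
    (b₁ b₂ b₃ n : ℕ) (k₀ : Γ) :
    ∑ ψ : AddChar Γ ℂ, ψ k₀ * wilsonFinTorusMagneticFluxPartition ρ β zM φ ψ b₁ b₂ b₃ n =
      (wilsonFinTorusTensorTwistedPartition ρ β (elecMagTwistTensor (φ k₀) zM) b₁ b₂ b₃ n : ℂ) :=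
  sum_apply_mul_fluxSector (Γ := Γ)
    (fun k n' => wilsonFinTorusTensorTwistedPartition ρ β (elecMagTwistTensor (φ k) zM) b₁ b₂ b₃ n') n k₀

section Spectral

variable [SecondCountableTopology G]

/-- **The twisted time slicing for the tensor `elecMagTwistTensor zE zM`, iterate form**, rewritten on the magnetic slice
tensor of `zM` and the electric slice twist of `zE` (the `hz` hypothesis of the kernel-level flux-sector theorems).
[cite: tHooft1979Flux, §5 (5.1)–(5.4)] [cite: MontvayMunster1994, §3.2.6 (3.145)] -/
theorem wilsonFinTorusTensorTwistedPartition_elecMag_eq_integral_iterate (hρ : Continuous ρ) (β : ℝ) {zE : Fin 4 → G}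
    (hzE : ∀ i : Fin 3, zE i.castSucc ∈ Subgroup.center G) (zM : Fin 4 → Fin 4 → G) (b₁ b₂ b₃ M : ℕ) :
    wilsonFinTorusTensorTwistedPartition ρ β (elecMagTwistTensor zE zM) b₁ b₂ b₃ (M + 2) =
      ∫ x, ((fun f : (FinSpatialSite b₁ b₂ b₃ × Fin 3 → G) → ℝ => fun u =>
            ∫ y, finTorusSliceKernelTw ρ β (finSliceTwistTensor zM) u y * f y
              ∂(Measure.pi fun _ : FinSpatialSite b₁ b₂ b₃ × Fin 3 => haarProbability G))^[M + 1]
          (fun y => finTorusSliceKernelTw ρ β (finSliceTwistTensor zM) y x)) (finSliceTwist zE x)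
        ∂(Measure.pi fun _ : FinSpatialSite b₁ b₂ b₃ × Fin 3 => haarProbability G) := by
  have hz : ∀ i : Fin 3, elecMagTwistTensor zE zM i.castSucc 3 ∈ Subgroup.center G := fun i => by
    rw [elecMagTwistTensor_three]; exact hzE i
  have h := wilsonFinTorusTensorTwistedPartition_eq_integral_iterate ρ hρ β hz b₁ b₂ b₃ M
  have hE : (fun μ => elecMagTwistTensor zE zM μ 3) = zE := funext fun μ => elecMagTwistTensor_three zE zM μ
  rw [finSliceTwistTensor_elecMagTwistTensor, hE] at h
  exact h

/-- ★ **`e^{−βF(e, m)} ≥ 0` AND REAL, in every magnetic sector, by the transfer matrix** ('t Hooft (5.1) made a theorem about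
the definition (5.4)): for `β ≥ 0`, continuous unitary `ρ`, EVERY box `b₁ × b₂ × b₃ × (M+2)`, every magnetic twist tensor `zM`
(arbitrary, `G`-valued) and every electric flux `ψ`: `0 ≤ Re Z_{ψ,m}(M+2)` and `Im Z_{ψ,m}(M+2) = 0`.  Mechanism:
`Z_{ψ,m}(M+2) = Σᵢ λᵢ(m)^M qᵢ(ψ)` with `λᵢ(m) ≥ 0` (Lüscher positivity of the TWISTED transfer operator `𝕋_m`,
`posType_finTorusSliceKernelTw`) and `qᵢ(ψ) = ‖P_ψ κbᵢ‖² ≥ 0`. [cite: tHooft1979Flux, §5 (5.1)–(5.4)] [cite: Luscher1977] -/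
theorem wilsonFinTorusMagneticFluxPartition_nonneg (hρ : Continuous ρ) (hρu : ∀ g, ρ g ∈ Matrix.unitaryGroup (Fin N) ℂ)
    {β : ℝ} (hβ : 0 ≤ β) (zM : Fin 4 → Fin 4 → G) {φ : Γ → Fin 4 → G} (hφ0 : φ 0 = 1)
    (hφadd : ∀ k k', φ (k + k') = φ k * φ k') (hφc : ∀ k (i : Fin 3), φ k i.castSucc ∈ Subgroup.center G)
    (ψ : AddChar Γ ℂ) (b₁ b₂ b₃ M : ℕ) :
    0 ≤ (wilsonFinTorusMagneticFluxPartition ρ β zM φ ψ b₁ b₂ b₃ (M + 2)).re ∧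
      (wilsonFinTorusMagneticFluxPartition ρ β zM φ ψ b₁ b₂ b₃ (M + 2)).im = 0 := by
  haveI : IsFiniteMeasure (haarProbability G) := by
    dsimp [haarProbability]; infer_instance
  obtain ⟨C, A, s, hcnt, b, lam, i₀, hC, hA, hb, hlam, -, -⟩ :=
    exists_eigenbasis_finTorusSliceKernelTw hρ hρu hβ (finSliceTwistTensor zM : FinSpatialSite b₁ b₂ b₃ → Fin 3 → Fin 3 → G)
  haveI : Countable s := hcnt
  have hK := stronglyMeasurable_uncurry_finTorusSliceKernelTw (b₁ := b₁) (b₂ := b₂) (b₃ := b₃) ρ hρ β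
    (finSliceTwistTensor zM)
  have hsymm : ∀ x y : FinSpatialSite b₁ b₂ b₃ × Fin 3 → G,
      finTorusSliceKernelTw ρ β (finSliceTwistTensor zM) x y = finTorusSliceKernelTw ρ β (finSliceTwistTensor zM) y x :=
    finTorusSliceKernelTw_symm ρ hρu β _
  have hT0 : (finSliceTwist (φ 0) : (FinSpatialSite b₁ b₂ b₃ × Fin 3 → G) → _) = id := by
    rw [hφ0]; exact finSliceTwist_one
  have hTadd : ∀ (k k' : Γ) (x : FinSpatialSite b₁ b₂ b₃ × Fin 3 → G),
      finSliceTwist (φ (k + k')) x = finSliceTwist (φ k) (finSliceTwist (φ k') x) := fun k k' x => by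
    rw [finSliceTwist_finSliceTwist, hφadd]
  exact fluxSector_nonneg (T := fun k => finSliceTwist (φ k)) hK hC hsymm hA hb (fun i => (hlam i).1)
    (fun k => measurePreserving_finSliceTwist (φ k)) hT0 hTadd
    (z := fun k n => wilsonFinTorusTensorTwistedPartition ρ β (elecMagTwistTensor (φ k) zM) b₁ b₂ b₃ n)
    (fun k M => wilsonFinTorusTensorTwistedPartition_elecMag_eq_integral_iterate ρ hρ β (hφc k) zM b₁ b₂ b₃ M) ψ M

/-- **Each electric sector is at most the whole magnetic sector**: `Re Z_{ψ,m}(M+2) ≤ W{0,m}(M+2)` (all sectors `≥ 0`, summing to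
`W{0,m}`). [cite: tHooft1979Flux, §5 (5.4)] [cite: Kanazawa2008, §2 Lemma 2 eq. (17)–(18)] -/
theorem re_wilsonFinTorusMagneticFluxPartition_le (hρ : Continuous ρ) (hρu : ∀ g, ρ g ∈ Matrix.unitaryGroup (Fin N) ℂ)
    {β : ℝ} (hβ : 0 ≤ β) (zM : Fin 4 → Fin 4 → G) {φ : Γ → Fin 4 → G} (hφ0 : φ 0 = 1)
    (hφadd : ∀ k k', φ (k + k') = φ k * φ k') (hφc : ∀ k (i : Fin 3), φ k i.castSucc ∈ Subgroup.center G)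
    (ψ : AddChar Γ ℂ) (b₁ b₂ b₃ M : ℕ) :
    (wilsonFinTorusMagneticFluxPartition ρ β zM φ ψ b₁ b₂ b₃ (M + 2)).re ≤
      wilsonFinTorusTensorTwistedPartition ρ β (elecMagTwistTensor (1 : Fin 4 → G) zM) b₁ b₂ b₃ (M + 2) := by
  have hsum := congrArg Complex.re (sum_wilsonFinTorusMagneticFluxPartition ρ β zM hφ0 b₁ b₂ b₃ (M + 2))
  rw [Complex.re_sum, Complex.ofReal_re] at hsum
  rw [← hsum]
  exact Finset.single_le_sum
    (fun ψ' _ => (wilsonFinTorusMagneticFluxPartition_nonneg ρ hρ hρu hβ zM hφ0 hφadd hφc ψ' b₁ b₂ b₃ M).1)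
    (Finset.mem_univ ψ)

/-- ★ **THE SPECTRAL CONTENT OF THE ELECTRIC SECTORS AT FIXED MAGNETIC FLUX** (`β ≥ 0`, continuous unitary `ρ`, any box, any
magnetic twist tensor `zM`, any finite abelian group of central temporal twists).  There is `λ₀(m) > 0` — the norm of the twisted
transfer operator `𝕋_m` — with: (ground state of the magnetic sector is electric-flux free) `λ₀(m)^M·λ₀(m)² ≤ Re Z_{0,m}(M+2)`;
(excited) `Re Z_{ψ,m}(2) ≤ W{0,m}(2) − λ₀(m)²` for `ψ ≠ 0`; (gap) **`Re Z_{ψ,m}(M+2) ≤ (tanh(3Nβ·b₁b₂b₃)·λ₀(m))^M · Re Z_{ψ,m}(2)`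
for `ψ ≠ 0`** — at fixed magnetic flux, a non-zero electric flux costs at least Hopf's finite-volume gap per unit time.
[cite: tHooft1979Flux, §4 (4.3)–(4.5) and §5 (5.1)–(5.4)] [cite: Hopf1963, Thm 4] [cite: ReedSimonIV1978, Thm XIII.43 and Thm XIII.44] -/
theorem exists_magneticFluxSpectralData_wilsonFinTorus (hρ : Continuous ρ)
    (hρu : ∀ g, ρ g ∈ Matrix.unitaryGroup (Fin N) ℂ) {β : ℝ} (hβ : 0 ≤ β) (zM : Fin 4 → Fin 4 → G) {φ : Γ → Fin 4 → G}
    (hφ0 : φ 0 = 1) (hφadd : ∀ k k', φ (k + k') = φ k * φ k')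
    (hφc : ∀ k (i : Fin 3), φ k i.castSucc ∈ Subgroup.center G) (b₁ b₂ b₃ : ℕ) :
    ∃ lam₀ : ℝ, 0 < lam₀ ∧
      (∀ M : ℕ, lam₀ ^ M * lam₀ ^ 2 ≤ (wilsonFinTorusMagneticFluxPartition ρ β zM φ 0 b₁ b₂ b₃ (M + 2)).re) ∧
      (∀ ψ : AddChar Γ ℂ, ψ ≠ 0 →
        (wilsonFinTorusMagneticFluxPartition ρ β zM φ ψ b₁ b₂ b₃ 2).re ≤
          wilsonFinTorusTensorTwistedPartition ρ β (elecMagTwistTensor (1 : Fin 4 → G) zM) b₁ b₂ b₃ 2 - lam₀ ^ 2) ∧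
      (∀ ψ : AddChar Γ ℂ, ψ ≠ 0 → ∀ M : ℕ,
        (wilsonFinTorusMagneticFluxPartition ρ β zM φ ψ b₁ b₂ b₃ (M + 2)).re ≤
          (Real.tanh (3 * N * β * ((b₁ : ℝ) * b₂ * b₃)) * lam₀) ^ M *
            (wilsonFinTorusMagneticFluxPartition ρ β zM φ ψ b₁ b₂ b₃ 2).re) := by
  haveI : IsFiniteMeasure (haarProbability G) := by
    dsimp [haarProbability]; infer_instance
  obtain ⟨C, A, s, hcnt, b, lam, i₀, hC, hA, hb, hlam, hi₀, hL0⟩ :=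
    exists_eigenbasis_finTorusSliceKernelTw hρ hρu hβ (finSliceTwistTensor zM : FinSpatialSite b₁ b₂ b₃ → Fin 3 → Fin 3 → G)
  haveI : Countable s := hcnt
  have hK := stronglyMeasurable_uncurry_finTorusSliceKernelTw (b₁ := b₁) (b₂ := b₂) (b₃ := b₃) ρ hρ β
    (finSliceTwistTensor zM)
  have hsymm : ∀ x y : FinSpatialSite b₁ b₂ b₃ × Fin 3 → G,
      finTorusSliceKernelTw ρ β (finSliceTwistTensor zM) x y = finTorusSliceKernelTw ρ β (finSliceTwistTensor zM) y x :=
    finTorusSliceKernelTw_symm ρ hρu β _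
  have hKpos : ∀ x y : FinSpatialSite b₁ b₂ b₃ × Fin 3 → G, 0 < finTorusSliceKernelTw ρ β (finSliceTwistTensor zM) x y :=
    finTorusSliceKernelTw_pos ρ hρ β _
  have hT0 : (finSliceTwist (φ 0) : (FinSpatialSite b₁ b₂ b₃ × Fin 3 → G) → _) = id := by
    rw [hφ0]; exact finSliceTwist_one
  have hTadd : ∀ (k k' : Γ) (x : FinSpatialSite b₁ b₂ b₃ × Fin 3 → G),
      finSliceTwist (φ (k + k')) x = finSliceTwist (φ k) (finSliceTwist (φ k') x) := fun k k' x => by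
    rw [finSliceTwist_finSliceTwist, hφadd]
  have hT : ∀ k : Γ, MeasurePreserving (finSliceTwist (φ k) : (FinSpatialSite b₁ b₂ b₃ × Fin 3 → G) → _)
      (Measure.pi fun _ => haarProbability G) (Measure.pi fun _ => haarProbability G) :=
    fun k => measurePreserving_finSliceTwist (φ k)
  have hKT : ∀ (k : Γ) (x y : FinSpatialSite b₁ b₂ b₃ × Fin 3 → G),
      finTorusSliceKernelTw ρ β (finSliceTwistTensor zM) (finSliceTwist (φ k) x) (finSliceTwist (φ k) y) =
        finTorusSliceKernelTw ρ β (finSliceTwistTensor zM) x y :=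
    fun k x y => finTorusSliceKernelTw_finSliceTwist ρ (hφc k) β _ x y
  have hz : ∀ (k : Γ) (M : ℕ),
      (fun k n => wilsonFinTorusTensorTwistedPartition ρ β (elecMagTwistTensor (φ k) zM) b₁ b₂ b₃ n) k (M + 2) =
      ∫ x, ((fun f : (FinSpatialSite b₁ b₂ b₃ × Fin 3 → G) → ℝ => fun u =>
            ∫ y, finTorusSliceKernelTw ρ β (finSliceTwistTensor zM) u y * f y
              ∂(Measure.pi fun _ : FinSpatialSite b₁ b₂ b₃ × Fin 3 => haarProbability G))^[M + 1]
          (fun y => finTorusSliceKernelTw ρ β (finSliceTwistTensor zM) y x)) (finSliceTwist (φ k) x)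
        ∂(Measure.pi fun _ : FinSpatialSite b₁ b₂ b₃ × Fin 3 => haarProbability G) :=
    fun k M => wilsonFinTorusTensorTwistedPartition_elecMag_eq_integral_iterate ρ hρ β (hφc k) zM b₁ b₂ b₃ M
  have hlam0 : ∀ i, 0 ≤ lam i := fun i => (hlam i).1
  -- Hopf's ratio bound in the magnetic sector: `λᵢ ≤ τ λ₀` off the top index
  have hHopf : ∀ i, i ≠ i₀ → lam i ≤ Real.tanh (3 * N * β * ((b₁ : ℝ) * b₂ * b₃)) * lam i₀ := fun i hi => by
    have h := WilsonFinTorusHopfTw.abs_eigenvalue_le_tanh_mul (b₁ := b₁) (b₂ := b₂) (b₃ := b₃) ρ hρ hρu hβ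
      (finSliceTwistTensor zM) hA b hb hi₀ hi
    rw [← hi₀] at h
    exact (le_abs_self _).trans h
  have h1 : wilsonFinTorusTensorTwistedPartition ρ β (elecMagTwistTensor (φ 0) zM) b₁ b₂ b₃ 2 =
      wilsonFinTorusTensorTwistedPartition ρ β (elecMagTwistTensor (1 : Fin 4 → G) zM) b₁ b₂ b₃ 2 := by
    rw [hφ0]
  refine ⟨lam i₀, lt_of_le_of_ne (hlam0 i₀) (Ne.symm hL0), fun M => ?_, fun ψ hψ => ?_, fun ψ hψ M => ?_⟩
  · exact le_re_fluxSector_zero (T := fun k => finSliceTwist (φ k)) hK hC hsymm hKpos hA hb hlam0 hi₀ hL0 hT hT0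
      hTadd hKT hz M
  · have h := re_fluxSector_le_sub (T := fun k => finSliceTwist (φ k)) hK hC hsymm hKpos hA hb hlam0 hi₀ hL0 hT hT0
      hTadd hKT hz hψ
    rw [wilsonFinTorusMagneticFluxPartition_def, ← h1]
    exact h
  · exact re_fluxSector_le_pow_mul (T := fun k => finSliceTwist (φ k)) hK hC hsymm hKpos hA hb hlam0 hi₀ hL0 hHopf hT
      hT0 hTadd hKT hz hψ M

/-- **The electric-flux-free part of a magnetic sector is strictly positive**: `0 < Re Z_{0,m}(M+2)` (it carries `λ₀(m)^{M+2} > 0`).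
[cite: tHooft1979Flux, §4 (4.3)–(4.5) and §5 (5.3)] -/
theorem wilsonFinTorusMagneticFluxPartition_zero_pos (hρ : Continuous ρ)
    (hρu : ∀ g, ρ g ∈ Matrix.unitaryGroup (Fin N) ℂ) {β : ℝ} (hβ : 0 ≤ β) (zM : Fin 4 → Fin 4 → G) {φ : Γ → Fin 4 → G}
    (hφ0 : φ 0 = 1) (hφadd : ∀ k k', φ (k + k') = φ k * φ k')
    (hφc : ∀ k (i : Fin 3), φ k i.castSucc ∈ Subgroup.center G) (b₁ b₂ b₃ M : ℕ) :
    0 < (wilsonFinTorusMagneticFluxPartition ρ β zM φ 0 b₁ b₂ b₃ (M + 2)).re := by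
  obtain ⟨lam₀, hpos, hvac, -, -⟩ := exists_magneticFluxSpectralData_wilsonFinTorus ρ hρ hρu hβ zM hφ0 hφadd hφc b₁ b₂ b₃
  exact lt_of_lt_of_le (by positivity) (hvac M)

end Spectral

/-! ### §2 The bridge to `wilsonFinTorusFluxTransform`: `e^{−βF(e, m; a, β)} ≥ 0` for every `(e, m)` -/

section Transform

/-- **The electric-flux character of `Γ³` with components `ψ₀, ψ₁, ψ₂`**: `(k₀, k₁, k₂) ↦ ψ₀(k₀) ψ₁(k₁) ψ₂(k₂)` — 't Hooft's
`e^{2πi(k·e)/N}` for `e = (e₁, e₂, e₃)`, `k ∈ ℤ_N³`. [cite: tHooft1979Flux, §4 (4.5) and §5 (5.2)] -/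
def tripleFluxChar (ψ₀ ψ₁ ψ₂ : AddChar Γ ℂ) : AddChar (Γ × Γ × Γ) ℂ where
  toFun k := ψ₀ k.1 * ψ₁ k.2.1 * ψ₂ k.2.2
  map_zero_eq_one' := by simp
  map_add_eq_mul' k k' := by
    simp only [Prod.fst_add, Prod.snd_add, AddChar.map_add_eq_mul]
    ring

omit [Fintype Γ] in
/-- `tripleFluxChar ψ₀ ψ₁ ψ₂ (k₀, k₁, k₂) = ψ₀ k₀ · ψ₁ k₁ · ψ₂ k₂`. [cite: tHooft1979Flux, §4 (4.5)] -/
@[simp] theorem tripleFluxChar_apply (ψ₀ ψ₁ ψ₂ : AddChar Γ ℂ) (k : Γ × Γ × Γ) :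
    tripleFluxChar ψ₀ ψ₁ ψ₂ k = ψ₀ k.1 * ψ₁ k.2.1 * ψ₂ k.2.2 := rfl

omit [Fintype Γ] in
/-- The triple character is trivial iff all three components are: `e = 0 ⇔ e₁ = e₂ = e₃ = 0`.
[cite: tHooft1979Flux, §4 (4.5)] -/
theorem tripleFluxChar_eq_zero_iff (ψ₀ ψ₁ ψ₂ : AddChar Γ ℂ) :
    tripleFluxChar ψ₀ ψ₁ ψ₂ = 0 ↔ ψ₀ = 0 ∧ ψ₁ = 0 ∧ ψ₂ = 0 := by
  constructor
  · intro h
    have hk : ∀ k : Γ × Γ × Γ, ψ₀ k.1 * ψ₁ k.2.1 * ψ₂ k.2.2 = 1 := fun k => by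
      rw [← tripleFluxChar_apply, h, AddChar.zero_apply]
    refine ⟨?_, ?_, ?_⟩
    · rw [AddChar.eq_zero_iff]; intro x; simpa using hk (x, 0, 0)
    · rw [AddChar.eq_zero_iff]; intro x; simpa using hk (0, x, 0)
    · rw [AddChar.eq_zero_iff]; intro x; simpa using hk (0, 0, x)
  · rintro ⟨h₀, h₁, h₂⟩
    ext k
    simp [h₀, h₁, h₂]

omit [TopologicalSpace G] [IsTopologicalGroup G] [CompactSpace G] [MeasurableSpace G] [BorelSpace G] [Fintype Γ] in
/-- **The twist tensor of (5.4) splits into its electric and magnetic parts**: for `φ 0 = 1`,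
`φ ∘ twistIdx (k₀,k₁,k₂ | m₁₂,m₀₂,m₀₁) = elecMagTwistTensor ![φ k₀, φ k₁, φ k₂, 1] (φ ∘ twistIdx (0,0,0 | m₁₂,m₀₂,m₀₁))`.
[cite: tHooft1979Flux, §2 (2.5)] -/
theorem twistIdx_eq_elecMagTwistTensor {φ : Γ → G} (hφ0 : φ 0 = 1) (k₀ k₁ k₂ m₁₂ m₀₂ m₀₁ : Γ) :
    (fun μ ν => φ (twistIdx k₀ k₁ k₂ m₁₂ m₀₂ m₀₁ μ ν)) =
      elecMagTwistTensor ![φ k₀, φ k₁, φ k₂, 1] (fun μ ν => φ (twistIdx (0 : Γ) 0 0 m₁₂ m₀₂ m₀₁ μ ν)) := by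
  funext μ ν
  fin_cases μ <;> fin_cases ν <;> simp [twistIdx, elecMagTwistTensor, hφ0]

/-- ★ **BRIDGE: the flux transform of `WilsonFinTorusTHooftDuality.lean` is the `Γ³`-sector partition function at the magnetic
tensor of `(m₁₂, m₀₂, m₀₁)`**: for `φ 0 = 1`,
`wilsonFinTorusFluxTransform ρ β φ ψ₀ ψ₁ ψ₂ m₁₂ m₀₂ m₀₁ a b c d =
 wilsonFinTorusMagneticFluxPartition ρ β (φ ∘ twistIdx (0,0,0 | m)) (k ↦ ![φ k₀, φ k₁, φ k₂, 1]) (tripleFluxChar ψ₀ ψ₁ ψ₂) a b c d`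
(the nested triple transform `|Γ|⁻³ Σ_{k₀,k₁,k₂}` is one transform over `Γ³`). [cite: tHooft1979Flux, §5 (5.4)] -/
theorem wilsonFinTorusFluxTransform_eq_magneticFluxPartition (β : ℝ) {φ : Γ → G} (hφ0 : φ 0 = 1)
    (ψ₀ ψ₁ ψ₂ : AddChar Γ ℂ) (m₁₂ m₀₂ m₀₁ : Γ) (a b c d : ℕ) :
    wilsonFinTorusFluxTransform ρ β φ ψ₀ ψ₁ ψ₂ m₁₂ m₀₂ m₀₁ a b c d =
      wilsonFinTorusMagneticFluxPartition ρ β (fun μ ν => φ (twistIdx (0 : Γ) 0 0 m₁₂ m₀₂ m₀₁ μ ν))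
        (fun k : Γ × Γ × Γ => ![φ k.1, φ k.2.1, φ k.2.2, 1]) (tripleFluxChar ψ₀ ψ₁ ψ₂) a b c d := by
  rw [wilsonFinTorusFluxTransform_def, wilsonFinTorusMagneticFluxPartition_def]
  have hW : ∀ k₀ k₁ k₂ : Γ,
      wilsonFinTorusTensorTwistedPartition ρ β (fun μ ν => φ (twistIdx k₀ k₁ k₂ m₁₂ m₀₂ m₀₁ μ ν)) a b c d =
        wilsonFinTorusTensorTwistedPartition ρ β
          (elecMagTwistTensor ![φ k₀, φ k₁, φ k₂, 1] (fun μ ν => φ (twistIdx (0 : Γ) 0 0 m₁₂ m₀₂ m₀₁ μ ν))) a b c d :=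
    fun k₀ k₁ k₂ => by rw [twistIdx_eq_elecMagTwistTensor hφ0]
  simp only [Fintype.card_prod, Nat.cast_mul, mul_inv, Fintype.sum_prod_type, Finset.mul_sum, tripleFluxChar_apply,
    map_mul, hW]
  refine Finset.sum_congr rfl fun k₀ _ => Finset.sum_congr rfl fun k₁ _ => Finset.sum_congr rfl fun k₂ _ => ?_
  ring

omit [TopologicalSpace G] [IsTopologicalGroup G] [CompactSpace G] [MeasurableSpace G] [BorelSpace G] [Fintype Γ] in
/-- The three-slot twist family `k ↦ ![φ k₀, φ k₁, φ k₂, 1]` of a hom-like centre-valued `φ` is a central hom-like family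
(plumbing for the bridge). [cite: tHooft1979Flux, §4 (4.2) and (4.4)] -/
private theorem tripleTwist_hom {φ : Γ → G} (hφ0 : φ 0 = 1) (hφadd : ∀ k k', φ (k + k') = φ k * φ k')
    (hφc : ∀ k, φ k ∈ Subgroup.center G) :
    (fun k : Γ × Γ × Γ => (![φ k.1, φ k.2.1, φ k.2.2, 1] : Fin 4 → G)) 0 = 1 ∧
      (∀ k k' : Γ × Γ × Γ, (![φ (k + k').1, φ (k + k').2.1, φ (k + k').2.2, 1] : Fin 4 → G) =
        ![φ k.1, φ k.2.1, φ k.2.2, 1] * ![φ k'.1, φ k'.2.1, φ k'.2.2, 1]) ∧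
      ∀ (k : Γ × Γ × Γ) (i : Fin 3), (![φ k.1, φ k.2.1, φ k.2.2, 1] : Fin 4 → G) i.castSucc ∈ Subgroup.center G := by
  refine ⟨?_, fun k k' => ?_, fun k i => ?_⟩
  · funext μ
    fin_cases μ <;> simp [hφ0]
  · funext μ
    fin_cases μ <;> simp [hφadd]
  · fin_cases i
    · exact hφc _
    · exact hφc _
    · exact hφc _

/-- **Nested three-variable Fourier completeness**:
`Σ_{χ₀,χ₁,χ₂} |Γ|⁻¹Σ_{s₀} conj χ₀(s₀) · |Γ|⁻¹Σ_{s₁} conj χ₁(s₁) · |Γ|⁻¹Σ_{s₂} conj χ₂(s₂) · H(s₀,s₁,s₂) = H(0,0,0)`.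
[cite: Serre1977, §2.3 Thm 3 and §2.6 Thm 8 (ii)] -/
theorem sum_sum_sum_fluxProjection₃_eq (H : Γ → Γ → Γ → ℂ) :
    ∑ χ₀ : AddChar Γ ℂ, ∑ χ₁ : AddChar Γ ℂ, ∑ χ₂ : AddChar Γ ℂ,
      (Fintype.card Γ : ℂ)⁻¹ * ∑ s₀, conj (χ₀ s₀) * ((Fintype.card Γ : ℂ)⁻¹ * ∑ s₁, conj (χ₁ s₁) *
        ((Fintype.card Γ : ℂ)⁻¹ * ∑ s₂, conj (χ₂ s₂) * H s₀ s₁ s₂)) = H 0 0 0 := by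
  -- innermost: move `Σ_{χ₂}` inside and use completeness in the third slot
  have h2 : ∀ χ₀ χ₁ : AddChar Γ ℂ, ∑ χ₂ : AddChar Γ ℂ,
      (Fintype.card Γ : ℂ)⁻¹ * ∑ s₀, conj (χ₀ s₀) * ((Fintype.card Γ : ℂ)⁻¹ * ∑ s₁, conj (χ₁ s₁) *
        ((Fintype.card Γ : ℂ)⁻¹ * ∑ s₂, conj (χ₂ s₂) * H s₀ s₁ s₂)) =
      (Fintype.card Γ : ℂ)⁻¹ * ∑ s₀, conj (χ₀ s₀) * ((Fintype.card Γ : ℂ)⁻¹ * ∑ s₁, conj (χ₁ s₁) * H s₀ s₁ 0) := by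
    intro χ₀ χ₁
    rw [← Finset.mul_sum, Finset.sum_comm]
    congr 1
    refine Finset.sum_congr rfl fun s₀ _ => ?_
    rw [← Finset.mul_sum, ← Finset.mul_sum, Finset.sum_comm]
    congr 2
    refine Finset.sum_congr rfl fun s₁ _ => ?_
    rw [← Finset.mul_sum, sum_fluxProjection_eq (fun s₂ => H s₀ s₁ s₂)]
  have h1 : ∀ χ₀ : AddChar Γ ℂ, ∑ χ₁ : AddChar Γ ℂ,
      (Fintype.card Γ : ℂ)⁻¹ * ∑ s₀, conj (χ₀ s₀) * ((Fintype.card Γ : ℂ)⁻¹ * ∑ s₁, conj (χ₁ s₁) * H s₀ s₁ 0) =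
      (Fintype.card Γ : ℂ)⁻¹ * ∑ s₀, conj (χ₀ s₀) * H s₀ 0 0 := by
    intro χ₀
    rw [← Finset.mul_sum, Finset.sum_comm]
    congr 1
    refine Finset.sum_congr rfl fun s₀ _ => ?_
    rw [← Finset.mul_sum, sum_fluxProjection_eq (fun s₁ => H s₀ s₁ 0)]
  simp_rw [h2, h1]
  exact sum_fluxProjection_eq (fun s₀ => H s₀ 0 0)

/-- **Completeness of the electric fluxes at fixed magnetic flux**: `Σ_{e} e^{−F}(e | m; a,b,c,d) = W{0, m}(a,b,c,d)` — the purely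
magnetically twisted functional integral (every `φ`, every box, every real `β`).
[cite: tHooft1979Flux, §5 (5.2)–(5.4)] [cite: Serre1977, §2.6 Thm 8 (ii)] -/
theorem sum_sum_sum_wilsonFinTorusFluxTransform (β : ℝ) (φ : Γ → G) (m₁₂ m₀₂ m₀₁ : Γ) (a b c d : ℕ) :
    ∑ ψ₀ : AddChar Γ ℂ, ∑ ψ₁ : AddChar Γ ℂ, ∑ ψ₂ : AddChar Γ ℂ,
        wilsonFinTorusFluxTransform ρ β φ ψ₀ ψ₁ ψ₂ m₁₂ m₀₂ m₀₁ a b c d =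
      (wilsonFinTorusTensorTwistedPartition ρ β (fun μ ν => φ (twistIdx (0 : Γ) 0 0 m₁₂ m₀₂ m₀₁ μ ν)) a b c d : ℂ) := by
  simp only [wilsonFinTorusFluxTransform_def]
  exact sum_sum_sum_fluxProjection₃_eq (fun s₀ s₁ s₂ =>
    (wilsonFinTorusTensorTwistedPartition ρ β (fun μ ν => φ (twistIdx s₀ s₁ s₂ m₁₂ m₀₂ m₀₁ μ ν)) a b c d : ℂ))

variable [SecondCountableTopology G]

/-- ★ **'t HOOFT's `e^{−βF(e, m; a, β)} ≥ 0` AND REAL FOR EVERY ELECTRIC FLUX `e` AND EVERY MAGNETIC FLUX `m`** — the content of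
(5.1) «`e^{−βF} = Tr P(e, m) e^{−βH}`» as a theorem about the lattice definition (5.4): for `β ≥ 0`, every compact `G`, continuous
unitary `ρ`, every finite abelian `Γ` with a hom-like centre-valued twist map `φ` (`φ 0 = 1`, `φ (k+k') = φ k φ k'`, `φ k ∈ Z(G)`;
't Hooft: `ℤ_N → Z(SU(N))`), all fluxes `ψ₀, ψ₁, ψ₂ ∣ m₁₂, m₀₂, m₀₁` and every box `a × b × c × (M+2)` (odd sides included):
`0 ≤ Re e^{−F}` and `Im e^{−F} = 0`.  (The tree's `MultiTwist.electricFluxWeight_nonneg` is the site-reflection proof of this sign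
on the symmetric EVEN torus; here: transfer-matrix positivity in the magnetic sector, no reflection, no parity.)
[cite: tHooft1979Flux, §5 (5.1)–(5.4)] [cite: Luscher1977] -/
theorem wilsonFinTorusFluxTransform_nonneg (hρ : Continuous ρ) (hρu : ∀ g, ρ g ∈ Matrix.unitaryGroup (Fin N) ℂ)
    {β : ℝ} (hβ : 0 ≤ β) {φ : Γ → G} (hφ0 : φ 0 = 1) (hφadd : ∀ k k', φ (k + k') = φ k * φ k')
    (hφc : ∀ k, φ k ∈ Subgroup.center G) (ψ₀ ψ₁ ψ₂ : AddChar Γ ℂ) (m₁₂ m₀₂ m₀₁ : Γ) (a b c M : ℕ) :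
    0 ≤ (wilsonFinTorusFluxTransform ρ β φ ψ₀ ψ₁ ψ₂ m₁₂ m₀₂ m₀₁ a b c (M + 2)).re ∧
      (wilsonFinTorusFluxTransform ρ β φ ψ₀ ψ₁ ψ₂ m₁₂ m₀₂ m₀₁ a b c (M + 2)).im = 0 := by
  obtain ⟨h0, hadd, hc⟩ := tripleTwist_hom (Γ := Γ) hφ0 hφadd hφc
  rw [wilsonFinTorusFluxTransform_eq_magneticFluxPartition ρ β hφ0]
  exact wilsonFinTorusMagneticFluxPartition_nonneg ρ hρ hρu hβ _ h0 hadd hc _ a b c M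

/-- **`0 ≤ e^{−F}(e | m) ≤ W{0, m}`**: each flux transform is at most the purely magnetic twisted integral of its box.
[cite: tHooft1979Flux, §5 (5.4)] [cite: Kanazawa2008, §2 Lemma 2 eq. (17)–(18)] -/
theorem re_wilsonFinTorusFluxTransform_le (hρ : Continuous ρ) (hρu : ∀ g, ρ g ∈ Matrix.unitaryGroup (Fin N) ℂ)
    {β : ℝ} (hβ : 0 ≤ β) {φ : Γ → G} (hφ0 : φ 0 = 1) (hφadd : ∀ k k', φ (k + k') = φ k * φ k')
    (hφc : ∀ k, φ k ∈ Subgroup.center G) (ψ₀ ψ₁ ψ₂ : AddChar Γ ℂ) (m₁₂ m₀₂ m₀₁ : Γ) (a b c M : ℕ) :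
    (wilsonFinTorusFluxTransform ρ β φ ψ₀ ψ₁ ψ₂ m₁₂ m₀₂ m₀₁ a b c (M + 2)).re ≤
      wilsonFinTorusTensorTwistedPartition ρ β (fun μ ν => φ (twistIdx (0 : Γ) 0 0 m₁₂ m₀₂ m₀₁ μ ν)) a b c (M + 2) := by
  have hsum := congrArg Complex.re (sum_sum_sum_wilsonFinTorusFluxTransform ρ β φ m₁₂ m₀₂ m₀₁ a b c (M + 2))
  rw [Complex.ofReal_re, Complex.re_sum] at hsum
  simp_rw [Complex.re_sum] at hsum
  rw [← hsum]
  have hnn := fun χ₀ χ₁ χ₂ =>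
    (wilsonFinTorusFluxTransform_nonneg ρ hρ hρu hβ hφ0 hφadd hφc χ₀ χ₁ χ₂ m₁₂ m₀₂ m₀₁ a b c M).1
  calc (wilsonFinTorusFluxTransform ρ β φ ψ₀ ψ₁ ψ₂ m₁₂ m₀₂ m₀₁ a b c (M + 2)).re
      ≤ ∑ χ₂ : AddChar Γ ℂ, (wilsonFinTorusFluxTransform ρ β φ ψ₀ ψ₁ χ₂ m₁₂ m₀₂ m₀₁ a b c (M + 2)).re :=
        Finset.single_le_sum (fun χ₂ _ => hnn ψ₀ ψ₁ χ₂) (Finset.mem_univ ψ₂)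
    _ ≤ ∑ χ₁ : AddChar Γ ℂ, ∑ χ₂ : AddChar Γ ℂ,
          (wilsonFinTorusFluxTransform ρ β φ ψ₀ χ₁ χ₂ m₁₂ m₀₂ m₀₁ a b c (M + 2)).re :=
        Finset.single_le_sum (f := fun χ₁ => ∑ χ₂ : AddChar Γ ℂ,
          (wilsonFinTorusFluxTransform ρ β φ ψ₀ χ₁ χ₂ m₁₂ m₀₂ m₀₁ a b c (M + 2)).re)
          (fun χ₁ _ => Finset.sum_nonneg fun χ₂ _ => hnn ψ₀ χ₁ χ₂) (Finset.mem_univ ψ₁)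
    _ ≤ ∑ χ₀ : AddChar Γ ℂ, ∑ χ₁ : AddChar Γ ℂ, ∑ χ₂ : AddChar Γ ℂ,
          (wilsonFinTorusFluxTransform ρ β φ χ₀ χ₁ χ₂ m₁₂ m₀₂ m₀₁ a b c (M + 2)).re :=
        Finset.single_le_sum (f := fun χ₀ => ∑ χ₁ : AddChar Γ ℂ, ∑ χ₂ : AddChar Γ ℂ,
          (wilsonFinTorusFluxTransform ρ β φ χ₀ χ₁ χ₂ m₁₂ m₀₂ m₀₁ a b c (M + 2)).re)
          (fun χ₀ _ => Finset.sum_nonneg fun χ₁ _ => Finset.sum_nonneg fun χ₂ _ => hnn χ₀ χ₁ χ₂) (Finset.mem_univ ψ₀)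

/-- ★ **THE SPECTRAL CONTENT OF `e^{−βF(e, m; a, β)}` AT FIXED MAGNETIC FLUX** (`β ≥ 0`, continuous unitary `ρ`, hom-like
centre-valued `φ`, any box `a × b × c`, any `m = (m₁₂, m₀₂, m₀₁)`).  There is `λ₀(m) > 0` (the norm of the transfer operator of the
box with magnetic flux `m`) such that: (vacuum of the magnetic sector) `λ₀(m)^M·λ₀(m)² ≤ Re e^{−F}(0 | m; a,b,c,M+2)` for all `M`;
(excited) `Re e^{−F}(e | m; a,b,c,2) ≤ W{0,m}(a,b,c,2) − λ₀(m)²` for `e ≠ 0`; (gap) **`Re e^{−F}(e | m; a,b,c,M+2) ≤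
(tanh(3Nβ·abc)·λ₀(m))^M · Re e^{−F}(e | m; a,b,c,2)` for every `e = (ψ₀,ψ₁,ψ₂) ≠ 0` and every `M`** — «in the limit β → ∞, F becomes
the energy of the lowest state with the given flux»: at fixed `m`, `E(e, m) − E(0, m) ≥ −log tanh(3Nβ·abc) > 0` on one box.
[cite: tHooft1979Flux, §4 (4.3)–(4.5) and §5 (5.1)–(5.4)] [cite: Hopf1963, Thm 4] [cite: ReedSimonIV1978, Thm XIII.43 and Thm XIII.44] -/
theorem exists_fluxTransformSpectralData_wilsonFinTorus (hρ : Continuous ρ)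
    (hρu : ∀ g, ρ g ∈ Matrix.unitaryGroup (Fin N) ℂ) {β : ℝ} (hβ : 0 ≤ β) {φ : Γ → G} (hφ0 : φ 0 = 1)
    (hφadd : ∀ k k', φ (k + k') = φ k * φ k') (hφc : ∀ k, φ k ∈ Subgroup.center G) (m₁₂ m₀₂ m₀₁ : Γ) (a b c : ℕ) :
    ∃ lam₀ : ℝ, 0 < lam₀ ∧
      (∀ M : ℕ, lam₀ ^ M * lam₀ ^ 2 ≤ (wilsonFinTorusFluxTransform ρ β φ 0 0 0 m₁₂ m₀₂ m₀₁ a b c (M + 2)).re) ∧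
      (∀ ψ₀ ψ₁ ψ₂ : AddChar Γ ℂ, ¬ (ψ₀ = 0 ∧ ψ₁ = 0 ∧ ψ₂ = 0) →
        (wilsonFinTorusFluxTransform ρ β φ ψ₀ ψ₁ ψ₂ m₁₂ m₀₂ m₀₁ a b c 2).re ≤
          wilsonFinTorusTensorTwistedPartition ρ β (fun μ ν => φ (twistIdx (0 : Γ) 0 0 m₁₂ m₀₂ m₀₁ μ ν)) a b c 2 -
            lam₀ ^ 2) ∧
      (∀ ψ₀ ψ₁ ψ₂ : AddChar Γ ℂ, ¬ (ψ₀ = 0 ∧ ψ₁ = 0 ∧ ψ₂ = 0) → ∀ M : ℕ,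
        (wilsonFinTorusFluxTransform ρ β φ ψ₀ ψ₁ ψ₂ m₁₂ m₀₂ m₀₁ a b c (M + 2)).re ≤
          (Real.tanh (3 * N * β * ((a : ℝ) * b * c)) * lam₀) ^ M *
            (wilsonFinTorusFluxTransform ρ β φ ψ₀ ψ₁ ψ₂ m₁₂ m₀₂ m₀₁ a b c 2).re) := by
  obtain ⟨h0, hadd, hc⟩ := tripleTwist_hom (Γ := Γ) hφ0 hφadd hφc
  obtain ⟨lam₀, hpos, hvac, hexc, hgap⟩ := exists_magneticFluxSpectralData_wilsonFinTorus ρ hρ hρu hβ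
    (fun μ ν => φ (twistIdx (0 : Γ) 0 0 m₁₂ m₀₂ m₀₁ μ ν)) h0 hadd hc a b c
  have h1 : elecMagTwistTensor (1 : Fin 4 → G) (fun μ ν => φ (twistIdx (0 : Γ) 0 0 m₁₂ m₀₂ m₀₁ μ ν)) =
      fun μ ν => φ (twistIdx (0 : Γ) 0 0 m₁₂ m₀₂ m₀₁ μ ν) := by
    funext μ ν
    fin_cases μ <;> fin_cases ν <;> simp [twistIdx, elecMagTwistTensor, hφ0]
  have htriv : tripleFluxChar (0 : AddChar Γ ℂ) 0 0 = 0 := (tripleFluxChar_eq_zero_iff 0 0 0).2 ⟨rfl, rfl, rfl⟩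
  refine ⟨lam₀, hpos, fun M => ?_, fun ψ₀ ψ₁ ψ₂ hψ => ?_, fun ψ₀ ψ₁ ψ₂ hψ M => ?_⟩
  · rw [wilsonFinTorusFluxTransform_eq_magneticFluxPartition ρ β hφ0, htriv]
    exact hvac M
  · have hne : tripleFluxChar ψ₀ ψ₁ ψ₂ ≠ 0 := fun h => hψ ((tripleFluxChar_eq_zero_iff ψ₀ ψ₁ ψ₂).1 h)
    rw [wilsonFinTorusFluxTransform_eq_magneticFluxPartition ρ β hφ0, ← h1]
    exact hexc _ hne
  · have hne : tripleFluxChar ψ₀ ψ₁ ψ₂ ≠ 0 := fun h => hψ ((tripleFluxChar_eq_zero_iff ψ₀ ψ₁ ψ₂).1 h)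
    rw [wilsonFinTorusFluxTransform_eq_magneticFluxPartition ρ β hφ0,
      wilsonFinTorusFluxTransform_eq_magneticFluxPartition ρ β hφ0]
    exact hgap _ hne M

/-- **The electric-flux-free transform of every magnetic sector is strictly positive**: `0 < Re e^{−F}(0 | m; a,b,c,M+2)`.
[cite: tHooft1979Flux, §5 (5.3)–(5.4)] -/
theorem wilsonFinTorusFluxTransform_zero_pos (hρ : Continuous ρ) (hρu : ∀ g, ρ g ∈ Matrix.unitaryGroup (Fin N) ℂ)
    {β : ℝ} (hβ : 0 ≤ β) {φ : Γ → G} (hφ0 : φ 0 = 1) (hφadd : ∀ k k', φ (k + k') = φ k * φ k')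
    (hφc : ∀ k, φ k ∈ Subgroup.center G) (m₁₂ m₀₂ m₀₁ : Γ) (a b c M : ℕ) :
    0 < (wilsonFinTorusFluxTransform ρ β φ 0 0 0 m₁₂ m₀₂ m₀₁ a b c (M + 2)).re := by
  obtain ⟨lam₀, hpos, hvac, -, -⟩ :=
    exists_fluxTransformSpectralData_wilsonFinTorus ρ hρ hρu hβ hφ0 hφadd hφc m₁₂ m₀₂ m₀₁ a b c
  exact lt_of_lt_of_le (by positivity) (hvac M)

end Transform

end Literature.MathematicalPhysics.QuantumFieldTheory

end
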